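import Summits.BirchSwinnertonDyer.Rank1Residual.P2.PrintCf2SplitBadTwoMassValue
import Mathlib.NumberTheory.LegendreSymbol.ZModChar
import HarnessLib

set_option autoImplicit false
set_option linter.dupNamespace false

/-!
# Stub-ideation k3 g48 (family 3 «probe the extremes»; technique «decomposition with a provable glue») —
# crux 27851 `PrintCf2.SplitBadTwoLowerHalfOfFacts`, STUB `stub_heegnerIndexLowerAtTwo`
# R231 «J0-RECEPTACLE AUDIT» EXECUTED AS A TYPED RANGE CUT: the (49)–(50) range is a PARAMETER of every
# receptacle on 27851's LOWER path; the cut KEY ⊕ RANGE ⊕ COSET-VALUES with kernel glue; the extremal corner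
# `j = 0 ∧ 3 ≤ m` (the R3 endpoint `lMeasureJZero_classNumberOne_two` of the Katz lane); the `t`-perturbation test.

HONEST FRAMING.  Nothing here proves BSD, the crux, the stub, HARDEST (a) or any named fact; every `def` is a
RECEPTACLE WITH EXPLICIT BINDERS (a glue predicate — nothing is asserted), every `theorem` is proved, no `sorry`,
no instances, no notation.  Written against the TREE's `DeShalit1987.IsLMeasure` / `IsKatzDistribution₂` /
`LMeasureFactWith` / `MeasureValue` / `MeasureValueWitness` (P54) and `FiniteLevel.OnWitnesses` / `MassValue` (P61 (d)).

* §0 the KEY-PARAMETRIC HANDSHAKE (pure logic): the consumer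
  `Theorems.PrintCf2.RubinValueTwoLower.lower_two_of_DGal_of_subsetForall_of_katzValueExists` reads the Katz
  predicate ONLY as the key shared by `hR` (∃) and `hMCall` (∀) — `concl_of_keyed_handshake`; re-keying `hMCall`
  on a WEAKER key is a STRONGER hypothesis (`forall_key_anti`), re-keying `hR` on a weaker key is free (`exists_key_mono`).
* §1 `IsLMeasureOn R` — the tree's (49)–(50) predicate with the interpolation range cut to `R m j`
  (`R := ⊤` ⟺ `IsLMeasure`, `isLMeasure_iff_isLMeasureOn_top`; ANTITONE in `R`); the extremal corner
  `RJ0 m j := j = 0 ∧ 3 ≤ m` = the inlined range of the Katz lane's endpoint `KatzMeasureTwo.lMeasureJZero_classNumberOne_two`.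
* §2 `IsKatzDistribution₂On R` and ★ `IsLMeasureOn.isKatzDistribution₂On` — the tree's transport
  `IsLMeasure.isKatzDistribution₂` (II.4.17 (54)) is POINTWISE in the range point `(ρ, m, j)`: re-proved VERBATIM
  with `R` threaded (site L1 of the R231 table: the J0 transport is free).
* §3 the range-sliced receptacles of J22's cut: `LMeasureFactWithOn R` (∃-form: cutting the range makes it WEAKER —
  `lMeasureFactWithOn_of_lMeasureFactWith`), `OnWitnessesOn R` / `MeasureValueOn R` / `MassValueOn R` /
  `FrameContinuousOn R` (∀-over-witnesses: cutting the range makes them STRONGER — `onWitnesses_of_onWitnessesOn`),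
  ★ `measureValueOn_iff_massValueOn` (road A″'s finite-level equivalence re-proved VERBATIM for every `R`: the
  hypothesis `hL` is threaded, never used — site L3), `MeasureValueWitnessOn R` and ★ `measureValueWitnessOn_of_cut`
  (the J0-keyed cut glue, site L1) — so the ONLY place the full range is load-bearing is the KEY of §0 (site L2).
* §3b at `p = 2`: `JZeroEndpointBody` = the conclusion of the Katz lane's R3 endpoint VERBATIM, and
  ★ `lMeasureFactWithOn_RJ0_true_iff_endpoint`: it IS the `RJ0`-slice of PIECE 1 with `Extra := ⊤` (road A) — the
  twin discharges the re-typed binder BY NAME; for roads A′/A″ the slice carries `Extra := IsCosetValues`, which the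
  endpoint does NOT state (verdict γ: a coset-value conjunct is owed by the lane).
* §4 the `t`-PERTURBATION TEST (LEAD memo KATZ-RANGE g17 §3–§4: `μ ↦ (R_{h_t})_*μ`, `G₂ ↦ unit·G₂`): J22 reads
  `‖val‖ ≤ 2^{−M/2}` / `= 2^{−M/2}`, invariant under unit multiples (`norm_mul_le_iff_of_norm_eq_one`,
  `norm_mul_eq_iff_of_norm_eq_one`) — the `j = 0` period ambiguity does not bite the value clause.
* §5 (family 3, certified small cases) the FINITE HALF of the (c)-key «θ has EXACT dyadic level n(key)»: the three
  2-primary quadratic characters `χ₄, χ₈, χ₈'` take the value `−1` at a unit `≡ 1 (mod 2^{n−1})` (`decide`).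
* §6 (family 3, extremal weight) `ne_of_norm_eq_rpow`: a complex number of absolute value `N^{w/2}` with `N > 1`,
  `w ≠ 2` is not `N` — the smoothing factor `φ(𝔞) − N𝔞` of II.5.2 (4) is NONZERO for every character of weight
  `≠ 2` (finite order: `w = 0`; J22's frame type `(0,−1)`: `w = −1`), closing (P-iii) of row 138 at the type level.

References: [deShalit1987] II.4.16 (49)–(50) (p. 76–77), II.4.17 (54) (p. 78), II Thm. 4.14 (36) (p. 71),
II.5.2 (4) (p. 79–80); Rubin 1991 §4 Thm. 4.1; LEAD memo `Cruxes/KatzDistributionsAtTwoPrint/LEAD-MEMO-KATZ-RANGE-g17.md`.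
-/

noncomputable section

open scoped Classical
open NumberField IsDedekindDomain Field
open Literature.NumberTheory.GaloisRepresentations
open Literature.NumberTheory.EllipticCurves
open Literature.NumberTheory.EllipticCurves.DeShalit1987
open Summit.BirchSwinnertonDyer.Rank1Residual.P2.FiniteLevel

namespace Summit.BirchSwinnertonDyer.BirchSwinnertonDyer.Cruxes.SplitBadTwoLowerHalfOfFacts.RangeCutK3G48

/-! ## §0 The key-parametric handshake (site L2 of the R231 table) -/

section Handshake

variable {α : Type*} {Key Key₀ Good MC : α → Prop} {C : Prop}

/-- **The consumer reads the Katz predicate only as a KEY**: from `hR : ∃ g, Key g ∧ Good g` (R∃, the value in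
existence form), `hMCall : ∀ g, Key g → MC g` (MC⁻ keyed on the SAME predicate) and the key-free glue
`MC g → Good g → C` (p694174 + the norm comparison), the conclusion follows — for ANY `Key`.  This is literally the
proof term of `lower_two_of_DGal_of_subsetForall_of_katzValueExists` (`hMC := hMCall Ω δ Ωp G₂ hΩ hδ hG₂`). -/
theorem concl_of_keyed_handshake (hR : ∃ g, Key g ∧ Good g) (hMCall : ∀ g, Key g → MC g)
    (hglue : ∀ g, MC g → Good g → C) : C := by
  obtain ⟨g, hk, hg⟩ := hR
  exact hglue g (hMCall g hk) hg

/-- Re-keying the `∀`-side on a WEAKER key `Key₀ ⊇ Key` (e.g. the `j = 0` slice) is a STRONGER hypothesis. -/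
theorem forall_key_anti (hK : ∀ g, Key g → Key₀ g) (h : ∀ g, Key₀ g → MC g) : ∀ g, Key g → MC g :=
  fun g hg ↦ h g (hK g hg)

/-- Re-keying the `∃`-side on a weaker key is free. -/
theorem exists_key_mono (hK : ∀ g, Key g → Key₀ g) (h : ∃ g, Key g ∧ Good g) : ∃ g, Key₀ g ∧ Good g := by
  obtain ⟨g, hk, hg⟩ := h
  exact ⟨g, hK g hk, hg⟩

/-- **The J0 handshake**: with BOTH sides keyed on the weaker key the conclusion follows (the twin lane supplies
`hR₀`; the price is `hMCall₀`, i.e. MC⁻ keyed on the `j = 0` predicate — site L2, verdict (β) at the key). -/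
theorem concl_of_keyed_handshake₀ (hR₀ : ∃ g, Key₀ g ∧ Good g) (hMCall₀ : ∀ g, Key₀ g → MC g)
    (hglue : ∀ g, MC g → Good g → C) : C :=
  concl_of_keyed_handshake hR₀ hMCall₀ hglue

end Handshake

/-! ## §1 de Shalit's (49)–(50) with the interpolation range CUT to `R` -/

section LMeasure

variable {p : ℕ} [Fact p.Prime] {K : Type} [Field K] [NumberField K]

/-- **(49)–(50) on the sub-range `R`**: verbatim `DeShalit1987.IsLMeasure` with the extra binder `R m j →`.
`R := fun _ _ ↦ True` is the tree's predicate; `R := RJ0` is the range of the Katz lane's R3 endpoint.  A predicate on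
`μ` — nothing is asserted. [cite: deShalit1987, II.4.16 (49)–(50) (p. 76–77)] -/
def IsLMeasureOn (R : ℕ → ℕ → Prop) (ι : PadicAlgCl p ≃+* ℂ) (v vbar : HeightOneSpectrum (𝓞 K))
    (S : Finset (HeightOneSpectrum (𝓞 K))) (Ω δ : ℂ) (Ωp : ℂ_[p])
    (𝒰 : SubgroupTower (absoluteGaloisGroup K)) (μ : GroupDistribution 𝒰 ℂ_[p]) : Prop :=
  ∀ (ε : HeckeCharacter K) (e : FramedGaloisRep K (PadicAlgCl p) 1) (m j : ℕ), R m j →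
    IsPAdicAvatarOutside S ι ε e → j < m →
    ε.HasInfinityType (fun _ ↦ -(m : ℤ)) (fun _ ↦ (j : ℤ)) →
    (∀ w : HeightOneSpectrum (𝓞 K), w ∉ S → w ≠ vbar → ε.IsUnramifiedAt w) →
    𝒰.IsTowerContinuous (fun σ ↦ avatarValueAt e σ) →
    ∀ hL : LFunction.HasEntireContinuation (heckeLFunction ε),
      μ.integral (fun σ ↦ avatarValueAt e σ) =
        ((ι.symm (DeShalit1987.interpolationValue p v vbar S ε m j Ω δ (hL.continuation 0)) :
            PadicAlgCl p) : ℂ_[p]) * Ωp ^ (m + j)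

/-- **The extremal corner `j = 0`, `3 ≤ m`** — the inlined range of `KatzMeasureTwo.lMeasureJZero_classNumberOne_two`
(critical type `(−m, 0)`, de Shalit II.4.12 (32) itself, no `D`-operator). -/
def RJ0 : ℕ → ℕ → Prop := fun m j ↦ j = 0 ∧ 3 ≤ m

variable {ι : PadicAlgCl p ≃+* ℂ} {v vbar : HeightOneSpectrum (𝓞 K)} {S : Finset (HeightOneSpectrum (𝓞 K))}
  {Ω δ : ℂ} {Ωp : ℂ_[p]} {𝒰 : SubgroupTower (absoluteGaloisGroup K)} {μ : GroupDistribution 𝒰 ℂ_[p]}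

/-- `IsLMeasureOn` is ANTITONE in the range. -/
theorem IsLMeasureOn.anti {R R' : ℕ → ℕ → Prop} (hRR' : ∀ m j, R m j → R' m j)
    (h : IsLMeasureOn R' ι v vbar S Ω δ Ωp 𝒰 μ) : IsLMeasureOn R ι v vbar S Ω δ Ωp 𝒰 μ :=
  fun ε e m j hR ↦ h ε e m j (hRR' m j hR)

/-- The full predicate gives every slice. -/
theorem isLMeasureOn_of_isLMeasure (R : ℕ → ℕ → Prop) (h : IsLMeasure ι v vbar S Ω δ Ωp 𝒰 μ) :
    IsLMeasureOn R ι v vbar S Ω δ Ωp 𝒰 μ :=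
  fun ε e m j _ ↦ h ε e m j

/-- `R := ⊤` IS the tree's predicate. -/
theorem isLMeasure_iff_isLMeasureOn_top :
    IsLMeasure ι v vbar S Ω δ Ωp 𝒰 μ ↔ IsLMeasureOn (fun _ _ ↦ True) ι v vbar S Ω δ Ωp 𝒰 μ :=
  ⟨isLMeasureOn_of_isLMeasure _, fun h ε e m j ↦ h ε e m j trivial⟩

end LMeasure

/-! ## §2 The transport to `ℤ_p²` is POINTWISE in the range point (site L1) -/

section Transport

variable {p : ℕ} [Fact p.Prime] {K : Type} [Field K] [NumberField K]

/-- **(49)–(50) on the `ℤ_p²`-quotient, range cut to `R`**: verbatim `DeShalit1987.IsKatzDistribution₂` with `R m j →`.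
A predicate on `D` — nothing is asserted. [cite: deShalit1987, II.4.16 (49)–(50) (p. 76–77), II.4.17 (54) (p. 78)] -/
def IsKatzDistribution₂On (R : ℕ → ℕ → Prop) (ι : PadicAlgCl p ≃+* ℂ) (v vbar : HeightOneSpectrum (𝓞 K))
    (S : Finset (HeightOneSpectrum (𝓞 K))) (κ₁ κ₂ : ZpExtension K p) (lam : HeckeCharacter K)
    (Ω δ : ℂ) (Ωp : ℂ_[p]) (D : BoundedDistribution (padicIntSq p) ℂ_[p]) : Prop :=
  ∀ (ρ : HeckeCharacter K) (r : FramedGaloisRep K (PadicAlgCl p) 1) (m j : ℕ), R m j →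
    IsPAdicAvatarOf ι ρ r → FactorsThroughPair κ₁ κ₂ r → j < m →
    (lam * ρ).HasInfinityType (fun _ ↦ -(m : ℤ)) (fun _ ↦ (j : ℤ)) →
    (∀ w : HeightOneSpectrum (𝓞 K), w ∉ S → w ≠ vbar → (lam * ρ).IsUnramifiedAt w) →
    ∀ (hL : LFunction.HasEntireContinuation (heckeLFunction (lam * ρ)))
      (F : ℤ_[p] × ℤ_[p] → ℂ_[p]), (∀ σ, F (ZpExtension.pairCoord κ₁ κ₂ σ) = avatarValueAt r σ) →
      D.integral F =
        ((ι.symm (DeShalit1987.interpolationValue p v vbar S (lam * ρ) m j Ω δ (hL.continuation 0)) :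
            PadicAlgCl p) : ℂ_[p]) * Ωp ^ (m + j)

variable {ι : PadicAlgCl p ≃+* ℂ} {v vbar : HeightOneSpectrum (𝓞 K)} {S : Finset (HeightOneSpectrum (𝓞 K))}
  {κ₁ κ₂ : ZpExtension K p} {lam : HeckeCharacter K} {Ω δ : ℂ} {Ωp : ℂ_[p]}
  {𝒰 : SubgroupTower (absoluteGaloisGroup K)} {μ : GroupDistribution 𝒰 ℂ_[p]}
  {D : BoundedDistribution (padicIntSq p) ℂ_[p]}

/-- The full predicate gives every slice; `R := ⊤` is the tree's predicate. -/
theorem isKatzDistribution₂On_of_isKatzDistribution₂ (R : ℕ → ℕ → Prop)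
    (h : IsKatzDistribution₂ ι v vbar S κ₁ κ₂ lam Ω δ Ωp D) : IsKatzDistribution₂On R ι v vbar S κ₁ κ₂ lam Ω δ Ωp D :=
  fun ρ r m j _ ↦ h ρ r m j

theorem isKatzDistribution₂_iff_on_top :
    IsKatzDistribution₂ ι v vbar S κ₁ κ₂ lam Ω δ Ωp D ↔
      IsKatzDistribution₂On (fun _ _ ↦ True) ι v vbar S κ₁ κ₂ lam Ω δ Ωp D :=
  ⟨isKatzDistribution₂On_of_isKatzDistribution₂ _, fun h ρ r m j ↦ h ρ r m j trivial⟩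

/-- ★ **THE TRANSPORT IS POINTWISE IN THE RANGE POINT**: `IsLMeasureOn R` on `Γ_K` gives `IsKatzDistribution₂On R`
for the SAME `R` on the push-forward of `l·μ` to `ℤ_p²` — the tree's proof of `IsLMeasure.isKatzDistribution₂`
VERBATIM with `R m j` threaded (it instantiates (49)–(50) at `ε = λρ` of the SAME type `(−m, j)`).  Consequence for
the R231 audit: the J0 twin's `IsLMeasureOn RJ0` transports to the `ℤ_2²`-object at no cost (site L1, verdict α).
[cite: deShalit1987, II.4.16 (49)–(50) (p. 76–77), II.4.17 (54) (p. 78)] -/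
theorem IsLMeasureOn.isKatzDistribution₂On {R : ℕ → ℕ → Prop}
    (hμ : IsLMeasureOn R ι v vbar S Ω δ Ωp 𝒰 μ)
    (hU : ∀ n, IsOpen (𝒰.U n : Set (absoluteGaloisGroup K)))
    (hN : ⋂ n, (𝒰.U n : Set (absoluteGaloisGroup K)) ⊆ DeShalit1987.rayKer K p S)
    (hvbar : ((p : ℕ) : 𝓞 K) ∈ vbar.asIdeal)
    {l : FramedGaloisRep K (PadicAlgCl p) 1} (hl : IsPAdicAvatarOutside S ι lam l)
    (hlam : ∀ w : HeightOneSpectrum (𝓞 K), w ∉ S → ((p : ℕ) : 𝓞 K) ∉ w.asIdeal → lam.IsUnramifiedAt w)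
    (hind : κ₁.IsIndependent κ₂) :
    IsKatzDistribution₂On R ι v vbar S κ₁ κ₂ lam Ω δ Ωp
      (katzDistribution₂ μ (DeShalit1987.isTowerContinuous_pairCoord κ₁ κ₂ hU hN) l
        (DeShalit1987.isTowerContinuous_avatarValueAt hl hlam hU hN)) := by
  intro ρ r m j hR hr hκ hjm hinf hunr hL F hF
  have hFeq : F = ZpExtension.pairChar hind r := ZpExtension.eq_pairChar_of_forall_apply_pairCoord hind hκ hF
  have hFc : UniformContinuous F := by
    rw [hFeq]
    exact CompactSpace.uniformContinuous_of_continuous (ZpExtension.continuous_pairChar hind hκ)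
  have hF1 : ∀ x, ‖F x‖ ≤ 1 := fun x ↦ by
    obtain ⟨σ, rfl⟩ := ZpExtension.pairCoord_surjective hind x
    rw [hF]
    exact (norm_avatarValueAt_eq_one r σ).le
  have hunr' : ∀ w : HeightOneSpectrum (𝓞 K), w ∉ S → ((p : ℕ) : 𝓞 K) ∉ w.asIdeal →
      (lam * ρ).IsUnramifiedAt w :=
    fun w hwS hwp ↦ hunr w hwS fun h ↦ hwp (h ▸ hvbar)
  have hav : IsPAdicAvatarOutside S ι (lam * ρ) (FramedRep.twist r (detChar l)) :=
    hr.mul_twist_outside hl hlam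
  have htc : 𝒰.IsTowerContinuous (fun σ ↦ avatarValueAt (FramedRep.twist r (detChar l)) σ) :=
    DeShalit1987.isTowerContinuous_avatarValueAt hav hunr' hU hN
  rw [integral_katzDistribution₂ μ _ l _ hFc hF1, ← hμ (lam * ρ) _ m j hR hav hjm hinf hunr htc hL]
  exact μ.integral_congr fun σ ↦ by rw [hF, avatarValueAt_twist_detChar, mul_comm]

end Transport

/-! ## §3 The range-sliced receptacles of J22's cut (sites L1, L3) -/

section Receptacles

variable {p : ℕ} [Fact p.Prime] {K : Type} [Field K] [NumberField K]

/-- **The SHAPE of Thm. 4.14 with the range cut to `R` and an extra conjunct** (verbatim `LMeasureFactWith` with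
`IsLMeasureOn R`).  `∃`-form: a smaller range is a WEAKER fact — this is what a `j = 0` twin lane delivers
(`R := RJ0`, `Extra :=` its coset-value clause).  A receptacle — nothing is asserted.
[cite: deShalit1987, II Thm. 4.14 (36) (p. 71), II.4.16 (49)–(50) (p. 76–77)] -/
def LMeasureFactWithOn (R : ℕ → ℕ → Prop) (ι : PadicAlgCl p ≃+* ℂ) (v vbar : HeightOneSpectrum (𝓞 K))
    (Extra : Finset (HeightOneSpectrum (𝓞 K)) → (𝒰 : SubgroupTower (absoluteGaloisGroup K)) →
      GroupDistribution 𝒰 ℂ_[p] → Prop) : Prop :=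
  ∃ (Ω δ : ℂ) (Ωp : (unrIntegers p)ˣ), Ω ≠ 0 ∧
    (δ ^ 2 = (NumberField.discr K : ℂ) ∨ δ ^ 2 = -(NumberField.discr K : ℂ)) ∧
    ∀ (S : Finset (HeightOneSpectrum (𝓞 K))), v ∉ S → vbar ∉ S →
      ∃ (𝒰 : SubgroupTower (absoluteGaloisGroup K)) (μ : GroupDistribution 𝒰 ℂ_[p]),
        (∀ n, IsOpen (𝒰.U n : Set (absoluteGaloisGroup K))) ∧
        (⋂ n, (𝒰.U n : Set (absoluteGaloisGroup K))) ⊆ rayKer K p S ∧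
        μ.bound ≤ 1 ∧
        IsLMeasureOn R ι v vbar S Ω δ ((Ωp : unrIntegers p) : ℂ_[p]) 𝒰 μ ∧
        Extra S 𝒰 μ

variable {ι : PadicAlgCl p ≃+* ℂ} {v vbar : HeightOneSpectrum (𝓞 K)} {Sθ : Finset (HeightOneSpectrum (𝓞 K))}
  {Extra : Finset (HeightOneSpectrum (𝓞 K)) → (𝒰 : SubgroupTower (absoluteGaloisGroup K)) →
    GroupDistribution 𝒰 ℂ_[p] → Prop}
  {r l : FramedGaloisRep K (PadicAlgCl p) 1}

/-- `LMeasureFactWithOn` is ANTITONE in the range: the full-range shape (e.g. from the print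
`thmII414_exists_lMeasure[_cosetValues]`) gives every slice. -/
theorem LMeasureFactWithOn.anti {R R' : ℕ → ℕ → Prop} (hRR' : ∀ m j, R m j → R' m j)
    (h : LMeasureFactWithOn R' ι v vbar Extra) : LMeasureFactWithOn R ι v vbar Extra := by
  obtain ⟨Ω, δ, Ωp, hΩ, hδ, hS⟩ := h
  refine ⟨Ω, δ, Ωp, hΩ, hδ, fun S hvS hvbarS ↦ ?_⟩
  obtain ⟨𝒰, μ, h1, h2, h3, h4, h5⟩ := hS S hvS hvbarS
  exact ⟨𝒰, μ, h1, h2, h3, h4.anti hRR', h5⟩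

/-- The tree's shape (full range) gives the shape on every slice. -/
theorem lMeasureFactWithOn_of_lMeasureFactWith (R : ℕ → ℕ → Prop) (h : LMeasureFactWith ι v vbar Extra) :
    LMeasureFactWithOn R ι v vbar Extra := by
  obtain ⟨Ω, δ, Ωp, hΩ, hδ, hS⟩ := h
  refine ⟨Ω, δ, Ωp, hΩ, hδ, fun S hvS hvbarS ↦ ?_⟩
  obtain ⟨𝒰, μ, h1, h2, h3, h4, h5⟩ := hS S hvS hvbarS
  exact ⟨𝒰, μ, h1, h2, h3, isLMeasureOn_of_isLMeasure R h4, h5⟩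

/-- **«on every witness of the `R`-sliced shape at `Sθ` carrying `Extra`, `Q 𝒰 μ`»** (verbatim
`FiniteLevel.OnWitnesses` with `IsLMeasureOn R`).  `∀`-over-witnesses: a smaller range is a STRONGER statement.
A receptacle — nothing is asserted. -/
def OnWitnessesOn (R : ℕ → ℕ → Prop) (ι : PadicAlgCl p ≃+* ℂ) (v vbar : HeightOneSpectrum (𝓞 K))
    (Sθ : Finset (HeightOneSpectrum (𝓞 K)))
    (Extra : Finset (HeightOneSpectrum (𝓞 K)) → (𝒰 : SubgroupTower (absoluteGaloisGroup K)) →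
      GroupDistribution 𝒰 ℂ_[p] → Prop)
    (Q : (𝒰 : SubgroupTower (absoluteGaloisGroup K)) → GroupDistribution 𝒰 ℂ_[p] → Prop) : Prop :=
  ∀ (Ω δ : ℂ) (Ωp : (unrIntegers p)ˣ) (𝒰 : SubgroupTower (absoluteGaloisGroup K)) (μ : GroupDistribution 𝒰 ℂ_[p]),
    (∀ n, IsOpen (𝒰.U n : Set (absoluteGaloisGroup K))) →
    (⋂ n, (𝒰.U n : Set (absoluteGaloisGroup K))) ⊆ DeShalit1987.rayKer K p Sθ → μ.bound ≤ 1 →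
    IsLMeasureOn R ι v vbar Sθ Ω δ ((Ωp : unrIntegers p) : ℂ_[p]) 𝒰 μ → Extra Sθ 𝒰 μ → Q 𝒰 μ

/-- A slice-keyed `OnWitnessesOn R` gives the tree's `OnWitnesses` (more witnesses were covered). -/
theorem onWitnesses_of_onWitnessesOn {R : ℕ → ℕ → Prop}
    {Q : (𝒰 : SubgroupTower (absoluteGaloisGroup K)) → GroupDistribution 𝒰 ℂ_[p] → Prop}
    (h : OnWitnessesOn R ι v vbar Sθ Extra Q) : OnWitnesses ι v vbar Sθ Extra Q :=
  fun Ω δ Ωp 𝒰 μ hU hN hb hL hE ↦ h Ω δ Ωp 𝒰 μ hU hN hb (isLMeasureOn_of_isLMeasure R hL) hE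

/-- `OnWitnessesOn` is MONOTONE in the range (ANTITONE as a demand: larger range, fewer witnesses). -/
theorem OnWitnessesOn.mono_range {R R' : ℕ → ℕ → Prop}
    {Q : (𝒰 : SubgroupTower (absoluteGaloisGroup K)) → GroupDistribution 𝒰 ℂ_[p] → Prop}
    (hRR' : ∀ m j, R m j → R' m j) (h : OnWitnessesOn R ι v vbar Sθ Extra Q) :
    OnWitnessesOn R' ι v vbar Sθ Extra Q :=
  fun Ω δ Ωp 𝒰 μ hU hN hb hL hE ↦ h Ω δ Ωp 𝒰 μ hU hN hb (hL.anti hRR') hE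

/-- `OnWitnessesOn` is MONOTONE in `Q`. -/
theorem OnWitnessesOn.mono {R : ℕ → ℕ → Prop}
    {Q Q' : (𝒰 : SubgroupTower (absoluteGaloisGroup K)) → GroupDistribution 𝒰 ℂ_[p] → Prop}
    (hQ : ∀ 𝒰 μ, Q 𝒰 μ → Q' 𝒰 μ) (h : OnWitnessesOn R ι v vbar Sθ Extra Q) : OnWitnessesOn R ι v vbar Sθ Extra Q' :=
  fun Ω δ Ωp 𝒰 μ hU hN hb hL hE ↦ hQ 𝒰 μ (h Ω δ Ωp 𝒰 μ hU hN hb hL hE)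

/-- **PIECE 3 on the slice**: the value clause for every witness of the `R`-sliced shape (verbatim `MeasureValue`). -/
def MeasureValueOn (R : ℕ → ℕ → Prop) (ι : PadicAlgCl p ≃+* ℂ) (v vbar : HeightOneSpectrum (𝓞 K))
    (Sθ : Finset (HeightOneSpectrum (𝓞 K)))
    (Extra : Finset (HeightOneSpectrum (𝓞 K)) → (𝒰 : SubgroupTower (absoluteGaloisGroup K)) →
      GroupDistribution 𝒰 ℂ_[p] → Prop)
    (r l : FramedGaloisRep K (PadicAlgCl p) 1) (P : ℂ_[p] → Prop) : Prop :=
  OnWitnessesOn R ι v vbar Sθ Extra fun _ μ ↦ P (μ.integral fun σ ↦ avatarValueAt r σ * avatarValueAt l σ)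

/-- The slice-keyed value clause gives the tree's `MeasureValue`. -/
theorem measureValue_of_measureValueOn {R : ℕ → ℕ → Prop} {P : ℂ_[p] → Prop}
    (h : MeasureValueOn R ι v vbar Sθ Extra r l P) : MeasureValue ι v vbar Sθ Extra r l P :=
  fun Ω δ Ωp 𝒰 μ hU hN hb hL hE ↦ h Ω δ Ωp 𝒰 μ hU hN hb (isLMeasureOn_of_isLMeasure R hL) hE

/-- The frame integrand is tower-continuous on every witness of the slice (verbatim `FrameContinuous`). -/
def FrameContinuousOn (R : ℕ → ℕ → Prop) (ι : PadicAlgCl p ≃+* ℂ) (v vbar : HeightOneSpectrum (𝓞 K))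
    (Sθ : Finset (HeightOneSpectrum (𝓞 K)))
    (Extra : Finset (HeightOneSpectrum (𝓞 K)) → (𝒰 : SubgroupTower (absoluteGaloisGroup K)) →
      GroupDistribution 𝒰 ℂ_[p] → Prop)
    (r l : FramedGaloisRep K (PadicAlgCl p) 1) : Prop :=
  OnWitnessesOn R ι v vbar Sθ Extra (fun 𝒰 _ ↦ 𝒰.IsTowerContinuous fun σ ↦ avatarValueAt r σ * avatarValueAt l σ)

/-- **MASS FORM on the slice** (verbatim `MassValue`): the finite-level statement road A″ produces. -/
def MassValueOn (R : ℕ → ℕ → Prop) (ι : PadicAlgCl p ≃+* ℂ) (v vbar : HeightOneSpectrum (𝓞 K))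
    (Sθ : Finset (HeightOneSpectrum (𝓞 K)))
    (Extra : Finset (HeightOneSpectrum (𝓞 K)) → (𝒰 : SubgroupTower (absoluteGaloisGroup K)) →
      GroupDistribution 𝒰 ℂ_[p] → Prop)
    (r l : FramedGaloisRep K (PadicAlgCl p) 1) (ε : ℝ) : Prop :=
  OnWitnessesOn R ι v vbar Sθ Extra fun 𝒰 μ ↦ ∃ N : ℕ,
    (∀ n, N ≤ n → ∀ σ τ : absoluteGaloisGroup K, 𝒰.proj n σ = 𝒰.proj n τ →
      ‖avatarValueAt r σ * avatarValueAt l σ - avatarValueAt r τ * avatarValueAt l τ‖ ≤ ε) ∧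
    ‖μ.riemannSum (fun σ ↦ avatarValueAt r σ * avatarValueAt l σ) N‖ ≤ ε

/-- MASS FORM ⟹ value clause on the slice — the tree's proof VERBATIM: the range hypothesis `hL` is threaded and
NEVER used (site L3: road A″'s receptacle is range-free). -/
theorem measureValueOn_of_massValueOn {R : ℕ → ℕ → Prop} {ε : ℝ} (hε : 0 ≤ ε)
    (hcont : FrameContinuousOn R ι v vbar Sθ Extra r l) (h : MassValueOn R ι v vbar Sθ Extra r l ε) :
    MeasureValueOn R ι v vbar Sθ Extra r l (fun z ↦ ‖z‖ ≤ ε) := by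
  intro Ω δ Ωp 𝒰 μ hU hN hb hL hE
  obtain ⟨N, hosc, hRS⟩ := h Ω δ Ωp 𝒰 μ hU hN hb hL hE
  exact μ.norm_integral_le_of_riemannSum (hcont Ω δ Ωp 𝒰 μ hU hN hb hL hE) hb hε hosc le_rfl hRS

/-- Value clause ⟹ MASS FORM on the slice (verbatim). -/
theorem massValueOn_of_measureValueOn {R : ℕ → ℕ → Prop} {ε : ℝ} (hε : 0 < ε)
    (hcont : FrameContinuousOn R ι v vbar Sθ Extra r l)
    (h : MeasureValueOn R ι v vbar Sθ Extra r l (fun z ↦ ‖z‖ ≤ ε)) : MassValueOn R ι v vbar Sθ Extra r l ε := by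
  intro Ω δ Ωp 𝒰 μ hU hN hb hL hE
  have hf := hcont Ω δ Ωp 𝒰 μ hU hN hb hL hE
  obtain ⟨N, hosc⟩ := hf.exists_forall_norm_sub_le hε
  exact ⟨N, hosc, μ.norm_riemannSum_le_of_integral hf hb hε.le hosc (h Ω δ Ωp 𝒰 μ hU hN hb hL hE) le_rfl⟩

/-- ★ **Road A″'s equivalence holds on EVERY slice** (`ε > 0`; the stub's instance `ε = 2^{−M/2}`). -/
theorem measureValueOn_iff_massValueOn {R : ℕ → ℕ → Prop} {ε : ℝ} (hε : 0 < ε)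
    (hcont : FrameContinuousOn R ι v vbar Sθ Extra r l) :
    MeasureValueOn R ι v vbar Sθ Extra r l (fun z ↦ ‖z‖ ≤ ε) ↔ MassValueOn R ι v vbar Sθ Extra r l ε :=
  ⟨massValueOn_of_measureValueOn hε hcont, measureValueOn_of_massValueOn hε.le hcont⟩

/-- **ONE WITNESS of the slice** (verbatim `MeasureValueWitness` with `IsLMeasureOn R`).  `∃`-form: WEAKER than
the tree's; it is what the J0-keyed cut produces, and what a J0-keyed Katz object is built from (§2).
A receptacle — nothing is asserted. -/
def MeasureValueWitnessOn (R : ℕ → ℕ → Prop) (ι : PadicAlgCl p ≃+* ℂ) (v vbar : HeightOneSpectrum (𝓞 K))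
    (Sθ : Finset (HeightOneSpectrum (𝓞 K))) (r l : FramedGaloisRep K (PadicAlgCl p) 1)
    (P : ℂ_[p] → Prop) : Prop :=
  ∃ (Ω δ : ℂ) (Ωp : (unrIntegers p)ˣ) (𝒰 : SubgroupTower (absoluteGaloisGroup K)) (μ : GroupDistribution 𝒰 ℂ_[p]),
    Ω ≠ 0 ∧ (δ ^ 2 = (NumberField.discr K : ℂ) ∨ δ ^ 2 = -(NumberField.discr K : ℂ)) ∧
    (∀ n, IsOpen (𝒰.U n : Set (absoluteGaloisGroup K))) ∧
    (⋂ n, (𝒰.U n : Set (absoluteGaloisGroup K))) ⊆ rayKer K p Sθ ∧ μ.bound ≤ 1 ∧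
    IsLMeasureOn R ι v vbar Sθ Ω δ ((Ωp : unrIntegers p) : ℂ_[p]) 𝒰 μ ∧
    P (μ.integral fun σ ↦ avatarValueAt r σ * avatarValueAt l σ)

/-- The tree's witness is a witness of every slice. -/
theorem measureValueWitnessOn_of_measureValueWitness (R : ℕ → ℕ → Prop) {P : ℂ_[p] → Prop}
    (h : MeasureValueWitness ι v vbar Sθ r l P) : MeasureValueWitnessOn R ι v vbar Sθ r l P := by
  obtain ⟨Ω, δ, Ωp, 𝒰, μ, hΩ, hδ, hU, hN, hb, hμ, hP⟩ := h
  exact ⟨Ω, δ, Ωp, 𝒰, μ, hΩ, hδ, hU, hN, hb, isLMeasureOn_of_isLMeasure R hμ, hP⟩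

/-- ★ **THE J0-KEYED CUT GLUE** (verbatim `measureValueWitness_of_cut` on the slice): the `R`-sliced shape (what the
twin lane delivers, `R := RJ0`) ∧ `v, v̄ ∉ Sθ` ∧ the `R`-sliced value clause (what roads A′/A″ deliver — they never
read the range) ⟹ ONE `R`-sliced witness with the value.  Site L1: PIECES 1 and 3 re-key to `j = 0` for free. -/
theorem measureValueWitnessOn_of_cut {R : ℕ → ℕ → Prop} {P : ℂ_[p] → Prop}
    (hfact : LMeasureFactWithOn R ι v vbar Extra) (hvS : v ∉ Sθ) (hvbarS : vbar ∉ Sθ)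
    (hval : MeasureValueOn R ι v vbar Sθ Extra r l P) : MeasureValueWitnessOn R ι v vbar Sθ r l P := by
  obtain ⟨Ω, δ, Ωp, hΩ, hδ, hS⟩ := hfact
  obtain ⟨𝒰, μ, hU, hN, hb, hμ, hE⟩ := hS Sθ hvS hvbarS
  exact ⟨Ω, δ, Ωp, 𝒰, μ, hΩ, hδ, hU, hN, hb, hμ, hval Ω δ Ωp 𝒰 μ hU hN hb hμ hE⟩

/-- **Mixed keys do NOT glue for free**: the FULL-range value clause (`MeasureValue`, keyed on fewer witnesses) and
an `R`-sliced shape give an `R`-sliced witness only through a slice-keyed value clause — recorded as the exact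
implication that IS available: a slice-keyed clause from a full-keyed one PLUS a range-upgrade on witnesses
(`hup`: every `R`-sliced witness carrying `Extra` already satisfies the full range — e.g. by J0 RIGIDITY; this is
the price named at site L2 when it is paid on the measure side instead of at the MC key). -/
theorem measureValueOn_of_measureValue_of_upgrade {R : ℕ → ℕ → Prop} {P : ℂ_[p] → Prop}
    (hup : OnWitnessesOn R ι v vbar Sθ Extra fun 𝒰 μ ↦
      ∀ (Ω δ : ℂ) (Ωp : (unrIntegers p)ˣ), IsLMeasureOn R ι v vbar Sθ Ω δ ((Ωp : unrIntegers p) : ℂ_[p]) 𝒰 μ →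
        IsLMeasure ι v vbar Sθ Ω δ ((Ωp : unrIntegers p) : ℂ_[p]) 𝒰 μ)
    (h : MeasureValue ι v vbar Sθ Extra r l P) : MeasureValueOn R ι v vbar Sθ Extra r l P :=
  fun Ω δ Ωp 𝒰 μ hU hN hb hL hE ↦ h Ω δ Ωp 𝒰 μ hU hN hb (hup Ω δ Ωp 𝒰 μ hU hN hb hL hE Ω δ Ωp hL) hE

end Receptacles

/-! ## §3b At `p = 2`: the Katz lane's R3 endpoint IS the `RJ0`-slice of PIECE 1 with `Extra := ⊤` (road A) -/

section Endpoint

variable {K : Type} [Field K] [NumberField K]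

/-- **The body of `KatzMeasureTwo.lMeasureJZero_classNumberOne_two` at `(K, ι, v, v̄)`** — copied VERBATIM from
`Cruxes/KatzDistributionsAtTwoPrint/Lines/katz_measure_two_R3_endpoint.lean` (the `∃ (Ω δ Ω₂) … ∀ S … ∃ (𝒰, μ) …`
conclusion, range `(−m, 0)`, `3 ≤ m`, inlined).  A receptacle — nothing is asserted (the lane proves it under
`IsImaginaryQuadratic K`, `classNumber K = 1`, `2 = v v̄`). -/
def JZeroEndpointBody (ι : PadicAlgCl 2 ≃+* ℂ) (v vbar : HeightOneSpectrum (𝓞 K)) : Prop :=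
  ∃ (Ω δ : ℂ) (Ωp : (unrIntegers 2)ˣ), Ω ≠ 0 ∧
    (δ ^ 2 = (NumberField.discr K : ℂ) ∨ δ ^ 2 = -(NumberField.discr K : ℂ)) ∧
    ∀ (S : Finset (HeightOneSpectrum (𝓞 K))), v ∉ S → vbar ∉ S →
      ∃ (𝒰 : SubgroupTower (absoluteGaloisGroup K)) (μ : GroupDistribution 𝒰 ℂ_[2]),
        (∀ n, IsOpen (𝒰.U n : Set (absoluteGaloisGroup K))) ∧
        (⋂ n, (𝒰.U n : Set (absoluteGaloisGroup K))) ⊆ DeShalit1987.rayKer K 2 S ∧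
        μ.bound ≤ 1 ∧
        ∀ (ε : HeckeCharacter K) (e : FramedGaloisRep K (PadicAlgCl 2) 1) (m : ℕ),
          IsPAdicAvatarOutside S ι ε e → 3 ≤ m →
          ε.HasInfinityType (fun _ ↦ -(m : ℤ)) (fun _ ↦ ((0 : ℕ) : ℤ)) →
          (∀ w : HeightOneSpectrum (𝓞 K), w ∉ S → w ≠ vbar → ε.IsUnramifiedAt w) →
          𝒰.IsTowerContinuous (fun σ ↦ avatarValueAt e σ) →
          ∀ hL : LFunction.HasEntireContinuation (heckeLFunction ε),
            μ.integral (fun σ ↦ avatarValueAt e σ) =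
              ((ι.symm (DeShalit1987.interpolationValue 2 v vbar S ε m 0 Ω δ (hL.continuation 0)) :
                  PadicAlgCl 2) : ℂ_[2]) * ((Ωp : unrIntegers 2) : ℂ_[2]) ^ (m + 0)

variable {ι : PadicAlgCl 2 ≃+* ℂ} {v vbar : HeightOneSpectrum (𝓞 K)} {S : Finset (HeightOneSpectrum (𝓞 K))}
  {Ω δ : ℂ} {Ωp : ℂ_[2]} {𝒰 : SubgroupTower (absoluteGaloisGroup K)} {μ : GroupDistribution 𝒰 ℂ_[2]}

/-- The inlined `(−m, 0)`, `3 ≤ m` clause on one witness ⟺ `IsLMeasureOn RJ0` on it. -/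
theorem isLMeasureOn_RJ0_iff_inlined :
    IsLMeasureOn RJ0 ι v vbar S Ω δ Ωp 𝒰 μ ↔
      ∀ (ε : HeckeCharacter K) (e : FramedGaloisRep K (PadicAlgCl 2) 1) (m : ℕ),
        IsPAdicAvatarOutside S ι ε e → 3 ≤ m →
        ε.HasInfinityType (fun _ ↦ -(m : ℤ)) (fun _ ↦ ((0 : ℕ) : ℤ)) →
        (∀ w : HeightOneSpectrum (𝓞 K), w ∉ S → w ≠ vbar → ε.IsUnramifiedAt w) →
        𝒰.IsTowerContinuous (fun σ ↦ avatarValueAt e σ) →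
        ∀ hL : LFunction.HasEntireContinuation (heckeLFunction ε),
          μ.integral (fun σ ↦ avatarValueAt e σ) =
            ((ι.symm (DeShalit1987.interpolationValue 2 v vbar S ε m 0 Ω δ (hL.continuation 0)) :
                PadicAlgCl 2) : ℂ_[2]) * Ωp ^ (m + 0) := by
  constructor
  · intro h ε e m hav hm
    exact h ε e m 0 ⟨rfl, hm⟩ hav (by omega)
  · intro h ε e m j hR hav _ hinf hunr hcont hL
    obtain ⟨rfl, hm⟩ := hR
    exact h ε e m hav hm hinf hunr hcont hL

/-- ★ **THE TWIN DISCHARGES THE `RJ0`-SLICE OF PIECE 1 (road A, `Extra := ⊤`) ON THE NOSE**: the endpoint body at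
`(K, ι, v, v̄)` ⟺ `LMeasureFactWithOn RJ0 ι v v̄ ⊤`.  (For roads A′/A″ the slice needs `Extra := IsCosetValues` —
the coset-value conjunct II.5.2 (4), NOT part of the endpoint: site L3, verdict γ.) -/
theorem lMeasureFactWithOn_RJ0_true_iff_endpoint :
    LMeasureFactWithOn RJ0 ι v vbar (fun _ _ _ ↦ True) ↔ JZeroEndpointBody ι v vbar := by
  constructor
  · rintro ⟨Ω, δ, Ωp, hΩ, hδ, hS⟩
    refine ⟨Ω, δ, Ωp, hΩ, hδ, fun S hvS hvbarS ↦ ?_⟩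
    obtain ⟨𝒰, μ, h1, h2, h3, h4, -⟩ := hS S hvS hvbarS
    exact ⟨𝒰, μ, h1, h2, h3, isLMeasureOn_RJ0_iff_inlined.mp h4⟩
  · rintro ⟨Ω, δ, Ωp, hΩ, hδ, hS⟩
    refine ⟨Ω, δ, Ωp, hΩ, hδ, fun S hvS hvbarS ↦ ?_⟩
    obtain ⟨𝒰, μ, h1, h2, h3, h4⟩ := hS S hvS hvbarS
    exact ⟨𝒰, μ, h1, h2, h3, isLMeasureOn_RJ0_iff_inlined.mpr h4, trivial⟩

end Endpoint

/-! ## §4 The `t`-perturbation test: J22's norm reading is unit-invariant (site L7) -/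

section Perturbation

variable {𝕜 : Type*} [NormedDivisionRing 𝕜]

/-- `‖u‖ = 1` ⟹ (`‖u·z‖ ≤ c ↔ ‖z‖ ≤ c`): the value clause `P := (‖·‖ ≤ 2^{−M/2})` of J22 is invariant under the
unit multiples `G₂ ↦ l(h_t)(1+T₁)^{a_t}·G₂` / `val ↦ θ_W(t)·val` produced by the `j = 0` period ambiguity
(LEAD memo KATZ-RANGE g17 §3–§4). -/
theorem norm_mul_le_iff_of_norm_eq_one {u : 𝕜} (hu : ‖u‖ = 1) (z : 𝕜) (c : ℝ) : ‖u * z‖ ≤ c ↔ ‖z‖ ≤ c := by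
  rw [norm_mul, hu, one_mul]

/-- Same for the exact reading `‖val‖ = 2^{−M/2}` of `RubinValueExistsAtTwo` (road A). -/
theorem norm_mul_eq_iff_of_norm_eq_one {u : 𝕜} (hu : ‖u‖ = 1) (z : 𝕜) (c : ℝ) : ‖u * z‖ = c ↔ ‖z‖ = c := by
  rw [norm_mul, hu, one_mul]

/-- The sign case `u = −1` (the quadratic `θ_W(t) = ±1`). -/
theorem norm_neg_mul_le_iff (z : 𝕜) (c : ℝ) : ‖(-1 : 𝕜) * z‖ ≤ c ↔ ‖z‖ ≤ c := by
  rw [neg_one_mul, norm_neg]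

end Perturbation

/-! ## §5 Certified small cases: the FINITE HALF of the (c)-key «θ has EXACT dyadic level n(key)» -/

section ExactLevel

/-- **Exactness witness, level `n = 2`** (keys with `d ≡ 3 (mod 4)`, 2-primary inertia character `χ₄`):
the unit `3 ≡ 1 (mod 2^{2−1})` has `χ₄(3) = −1`, so `χ₄` is non-trivial on `1 + 2ℤ₂` modulo `1 + 4ℤ₂`. -/
theorem chi4_exactLevel_two : (3 : ℕ) % 2 ^ (2 - 1) = 1 ∧ ZMod.χ₄ (3 : ZMod 4) = -1 := by decide

/-- **Exactness witness, level `n = 3`, character `χ₈`** (keys with `2 ∣ d`, `d/2 ≡ 1 (mod 4)` up to the odd part):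
`5 ≡ 1 (mod 2^{3−1})`, `χ₈(5) = −1`. -/
theorem chi8_exactLevel_three : (5 : ℕ) % 2 ^ (3 - 1) = 1 ∧ ZMod.χ₈ (5 : ZMod 8) = -1 := by decide

/-- **Exactness witness, level `n = 3`, character `χ₈'`** (the other even class): `5 ≡ 1 (mod 4)`, `χ₈'(5) = −1`. -/
theorem chi8'_exactLevel_three : (5 : ℕ) % 2 ^ (3 - 1) = 1 ∧ ZMod.χ₈' (5 : ZMod 8) = -1 := by decide

/-- The three 2-primary quadratic characters are DISTINGUISHED on the level-3 units `{1,3,5,7}` by their values at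
`3` and `5` (so the key's class `d mod 8` decides which table §B of road A″ reads). -/
theorem chi_table_mod_eight :
    (ZMod.χ₄ (3 : ZMod 4), ZMod.χ₄ (5 : ZMod 4)) = (-1, 1) ∧
    (ZMod.χ₈ (3 : ZMod 8), ZMod.χ₈ (5 : ZMod 8)) = (-1, -1) ∧
    (ZMod.χ₈' (3 : ZMod 8), ZMod.χ₈' (5 : ZMod 8)) = (1, -1) := by decide

end ExactLevel

/-! ## §6 Extremal weight: the smoothing factor `φ(𝔞) − N𝔞` of II.5.2 (4) is nonzero off weight 2 -/

section Weight

/-- **`‖φ‖ = N^{w/2}`, `N > 1`, `w ≠ 2` ⟹ `φ ≠ N`.**  For a Hecke character of infinity type `(k, j)` one has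
`|φ(𝔞)|² = N𝔞^{k+j}`; so the smoothing factor `φ(𝔞) − N𝔞` (II.5.2 (4), `𝔞 ≠ 1`) vanishes only in weight
`k + j = 2`: NEVER for the finite-order characters of `IsCosetValues` (`w = 0`) nor for J22's frame type `(0, −1)`
(`w = −1`) — the 2-adic digit `s_𝔞 = v₂(φ(𝔞) − N𝔞)` of road A″ is therefore FINITE ((P-iii) of row 138). -/
theorem ne_of_norm_eq_rpow {φ : ℂ} {N : ℕ} {w : ℝ} (hN : 1 < N) (hφ : ‖φ‖ = (N : ℝ) ^ (w / 2)) (hw : w ≠ 2) :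
    φ ≠ (N : ℂ) := by
  intro h
  have hN' : (1 : ℝ) < (N : ℝ) := by exact_mod_cast hN
  have h1 : ‖φ‖ = (N : ℝ) ^ (1 : ℝ) := by rw [h, Complex.norm_natCast, Real.rpow_one]
  rw [hφ] at h1
  have h2 : w / 2 = 1 := (Real.rpow_right_inj (by linarith) hN'.ne').mp h1
  exact hw (by linarith)

/-- The finite-order case in the currency of `IsCosetValues` (`‖χ(σ_𝔞)‖ = 1 = N𝔞^{0/2}`): a complex number of
absolute value `1` is not an integer `N > 1`. -/
theorem ne_natCast_of_norm_eq_one {z : ℂ} {N : ℕ} (hN : 1 < N) (hz : ‖z‖ = 1) : z ≠ (N : ℂ) :=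
  ne_of_norm_eq_rpow (w := 0) hN (by rw [hz, zero_div, Real.rpow_zero]) (by norm_num)

/-- Hence the smoothing factor is NONZERO (so its 2-adic valuation, the digit `s_𝔞`, is a natural number). -/
theorem smoothingFactor_ne_zero {z : ℂ} {N : ℕ} (hN : 1 < N) (hz : ‖z‖ = 1) : z - (N : ℂ) ≠ 0 :=
  sub_ne_zero.mpr (ne_natCast_of_norm_eq_one hN hz)

end Weight

end Summit.BirchSwinnertonDyer.BirchSwinnertonDyer.Cruxes.SplitBadTwoLowerHalfOfFacts.RangeCutK3G48

end
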